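import Literature.MathematicalPhysics.KineticTheory.HarmonicChaosDecomposition
import Literature.MathematicalPhysics.KineticTheory.ZeroWavenumberSpace
import HarnessLib

/-!
# Fluctuation-side lemmas for the harmonic spectral formula: linearity of Doyon's form, transport of the generator
(stub `stub_wickShellDynamic` (K6) of line `gram-pencil-harmonic-chaos`, crux `EmbeddedDrudeMourre.DrudeDissolution`,
item stmt-AtomisticToContinuum-12593; `--supports` file, closes nothing)

WHAT. Bookkeeping on Doyon's zero-wavenumber space `ℋ₀(μ)` of a `ZeroWavenumberData`:
* `form_const_left/right`, `form_sum_smul_left/right`, `fluct_sum`: constants are null for the form, finite linear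
  combinations pass through both slots and through the class map on `𝒱`;
* `hasDerivAt_inner_koopman_fluct` (registered helper stub `inner_koopman_fluct_hasDerivAt`): if `s ↦ U_s[v]` has
  derivative `[w]` at `0` (the landed generator stub C gives this on polynomial classes), then `s ↦ ⟪ψ, U_s[v]⟫` has
  derivative `⟪ψ, U_t[w]⟫` at every `t` (group law + boundedness of `U_t`);
* the PRESENTATION lemmas for a Wick polynomial `P = Σ c_j :f_j: + Σ d_j :g_j: + c₀` and its chaos vector
  `Ψ = Σ c_j ι[:f_j:] + Σ d_j ι[:g_j:]`: membership in `𝒱`, `Z.form P b`, `Z.form a (P ∘ φ)`, `Re ⟪Ψ, X⟫`, `⟪Ψ, X⟫`,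
  `Re ⟪X, U⁰_t Ψ⟫` as the corresponding finite linear combinations.

HOW. `FluctuationStructure.form_add_left/right`, `form_smul_left/right`, `fluct_add`, Mathlib's
`covariance_const_left/right`, `FluctuationDynamics.koopman_add_apply`, `HasDerivAt.comp_sub_const`, `HasDerivAt.inner`.
-/

noncomputable section

namespace Summit.AtomisticToContinuum.FouriersLaw.Theorems.DrudeDissolution.GramPencilHarmonicChaos

open MeasureTheory Filter Set Function Topology
open scoped InnerProductSpace ENNReal ComplexConjugate
open Literature.MathematicalPhysics.KineticTheory
open Literature.MathematicalPhysics.KineticTheory.HeatConduction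
open HarmonicChaos ProbabilityTheory

section Datum

variable {P : OscillatorChain} {D : InfiniteChainDynamics P} (Z : ZeroWavenumberData P D)

/-- The form against a constant vanishes (covariances kill constants). [folklore] -/
theorem form_const_right (a : ChainConfig → ℝ) (c : ℝ) : Z.form a (fun _ => c) = 0 := by
  rw [FluctuationStructure.form_def]
  have h : ∀ x : ℤ, cov[a, (fun _ : ChainConfig => c) ∘ chainShift x; Z.μ] = 0 := fun x =>
    covariance_const_right c
  simp_rw [h, integral_zero]

/-- The form of a constant vanishes. [folklore] -/
theorem form_const_left (c : ℝ) (b : ChainConfig → ℝ) : Z.form (fun _ => c) b = 0 := by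
  rw [FluctuationStructure.form_def]
  have h : ∀ x : ℤ, cov[(fun _ : ChainConfig => c), b ∘ chainShift x; Z.μ] = 0 := fun x =>
    covariance_const_left c
  simp_rw [h, integral_zero]

/-- Finite linear combinations in the second slot of the form (on `𝒱`). [folklore] -/
theorem form_sum_smul_right {ι : Type*} (s : Finset ι) {a : ChainConfig → ℝ} (ha : a ∈ Z.localObs)
    (c : ι → ℝ) {v : ι → ChainConfig → ℝ} (hv : ∀ i ∈ s, v i ∈ Z.localObs) :
    Z.form a (∑ i ∈ s, c i • v i) = ∑ i ∈ s, c i * Z.form a (v i) := by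
  classical
  induction s using Finset.induction_on with
  | empty =>
    simp only [Finset.sum_empty]
    exact form_const_right Z a 0
  | insert j s hj ih =>
    have hv' : ∀ i ∈ s, v i ∈ Z.localObs := fun i hi => hv i (Finset.mem_insert_of_mem hi)
    rw [Finset.sum_insert hj, Finset.sum_insert hj,
      FluctuationStructure.form_add_right ha (Z.localObs.smul_mem _ (hv j (Finset.mem_insert_self j s)))
        (Z.localObs.sum_mem fun i hi => Z.localObs.smul_mem _ (hv' i hi)),
      FluctuationStructure.form_smul_right, ih hv']

/-- Finite linear combinations in the first slot of the form (on `𝒱`). [folklore] -/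
theorem form_sum_smul_left {ι : Type*} (s : Finset ι) (c : ι → ℝ) {v : ι → ChainConfig → ℝ}
    (hv : ∀ i ∈ s, v i ∈ Z.localObs) {b : ChainConfig → ℝ} (hb : b ∈ Z.localObs) :
    Z.form (∑ i ∈ s, c i • v i) b = ∑ i ∈ s, c i * Z.form (v i) b := by
  classical
  induction s using Finset.induction_on with
  | empty =>
    simp only [Finset.sum_empty]
    exact form_const_left Z 0 b
  | insert j s hj ih =>
    have hv' : ∀ i ∈ s, v i ∈ Z.localObs := fun i hi => hv i (Finset.mem_insert_of_mem hi)
    rw [Finset.sum_insert hj, Finset.sum_insert hj,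
      FluctuationStructure.form_add_left (Z.localObs.smul_mem _ (hv j (Finset.mem_insert_self j s)))
        (Z.localObs.sum_mem fun i hi => Z.localObs.smul_mem _ (hv' i hi)) hb,
      FluctuationStructure.form_smul_left, ih hv']

/-- The class map is additive over finite sums on `𝒱`. [folklore] -/
theorem fluct_sum {ι : Type*} (s : Finset ι) {v : ι → ChainConfig → ℝ} (hv : ∀ i ∈ s, v i ∈ Z.localObs) :
    Z.fluct (∑ i ∈ s, v i) = ∑ i ∈ s, Z.fluct (v i) := by
  classical
  induction s using Finset.induction_on with
  | empty => simp
  | insert j s hj ih =>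
    have hv' : ∀ i ∈ s, v i ∈ Z.localObs := fun i hi => hv i (Finset.mem_insert_of_mem hi)
    rw [Finset.sum_insert hj, Finset.sum_insert hj,
      FluctuationStructure.fluct_add (hv j (Finset.mem_insert_self j s)) (Z.localObs.sum_mem hv'), ih hv']

/-- **Transport of the generator identity along the group**: if `s ↦ U_s[v]` has derivative `[w]` at `0`,
then `s ↦ ⟪ψ, U_s[v]⟫` has derivative `⟪ψ, U_t[w]⟫` at every `t`. [folklore] -/
theorem hasDerivAt_inner_koopman_fluct (ψ : ZeroWavenumberSpace Z) {v w : ChainConfig → ℝ}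
    (hv : HasDerivAt (fun s : ℝ => (Z.koopman s (Z.fluct v) : ZeroWavenumberSpace Z)) (Z.fluct w) 0)
    (t : ℝ) :
    HasDerivAt (fun s : ℝ => ⟪ψ, Z.koopman s (Z.fluct v)⟫_ℝ) ⟪ψ, Z.koopman t (Z.fluct w)⟫_ℝ t := by
  -- compose with the bounded operator `U_t` and translate the base point
  have h1 : HasDerivAt (fun s : ℝ => (Z.koopman t (Z.koopman s (Z.fluct v)) : ZeroWavenumberSpace Z))
      (Z.koopman t (Z.fluct w)) 0 :=
    ((Z.koopman t).toContinuousLinearEquiv : ZeroWavenumberSpace Z →L[ℝ] ZeroWavenumberSpace Z)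
      |>.hasFDerivAt.comp_hasDerivAt 0 hv
  rw [show (0 : ℝ) = t - t by ring] at h1
  have h2 := h1.comp_sub_const t t
  have h3 : HasDerivAt (fun s : ℝ => (Z.koopman s (Z.fluct v) : ZeroWavenumberSpace Z))
      (Z.koopman t (Z.fluct w)) t := by
    refine h2.congr_of_eventuallyEq (Eventually.of_forall fun s => ?_)
    change Z.koopman s (Z.fluct v) = Z.koopman t (Z.koopman (s - t) (Z.fluct v))
    calc Z.koopman s (Z.fluct v) = Z.koopman (t + (s - t)) (Z.fluct v) :=
          congrArg (fun r => Z.koopman r (Z.fluct v)) (by ring)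
      _ = Z.koopman t (Z.koopman (s - t) (Z.fluct v)) :=
          Z.toFluctuationDynamics.koopman_add_apply t (s - t) _
  have h4 := (hasDerivAt_const t ψ).inner ℝ h3
  simpa using h4

end Datum

section Presentation

variable {P₀ : OscillatorChain} {D : InfiniteChainDynamics P₀} (Z : ZeroWavenumberData P₀ D)

/-- Constants are local polynomials. [folklore] -/
theorem const_mem_localPolynomials (c : ℝ) :
    (fun _ : ChainConfig => c) ∈ Algebra.adjoin ℝ (Set.range fun xc : ℤ × Bool => fun σ : ChainConfig =>
      if xc.2 then (σ xc.1).2 else (σ xc.1).1) := by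
  have h : (fun _ : ChainConfig => c) = algebraMap ℝ (ChainConfig → ℝ) c := by
    funext σ
    simp
  rw [h]
  exact Subalgebra.algebraMap_mem _ c

/-- The presented Wick polynomial as a linear combination of Wick monomials plus a constant. [folklore] -/
theorem presentation_eq (ω₂ : ℝ) {J J' : ℕ} (c : Fin J → ℝ) (f : Fin J → Fin 4 → TestFn) (d : Fin J' → ℝ)
    (g : Fin J' → Fin 2 → TestFn) (c₀ : ℝ) (θ : ChainConfig → ChainConfig) :
    (fun σ : ChainConfig => (∑ j : Fin J, c j * wick ω₂ 1 4 (f j) σ) +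
        (∑ j : Fin J', d j * wick ω₂ 1 2 (g j) σ) + c₀) ∘ θ =
      (∑ j, c j • (wick ω₂ 1 4 (f j) ∘ θ)) + (∑ j, d j • (wick ω₂ 1 2 (g j) ∘ θ)) + fun _ => c₀ := by
  funext σ
  simp only [comp_apply, Pi.add_apply, Finset.sum_apply, Pi.smul_apply, smul_eq_mul]

/-- The presented Wick polynomial is a local observable when the Wick monomials are. [folklore] -/
theorem presentation_comp_mem (ω₂ : ℝ) {J J' : ℕ} (c : Fin J → ℝ) (f : Fin J → Fin 4 → TestFn) (d : Fin J' → ℝ)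
    (g : Fin J' → Fin 2 → TestFn) (c₀ : ℝ) (θ : ChainConfig → ChainConfig)
    (h4 : ∀ j, wick ω₂ 1 4 (f j) ∘ θ ∈ Z.localObs) (h2 : ∀ j, wick ω₂ 1 2 (g j) ∘ θ ∈ Z.localObs)
    (hc : (fun _ : ChainConfig => c₀) ∈ Z.localObs) :
    (fun σ : ChainConfig => (∑ j : Fin J, c j * wick ω₂ 1 4 (f j) σ) +
        (∑ j : Fin J', d j * wick ω₂ 1 2 (g j) σ) + c₀) ∘ θ ∈ Z.localObs := by
  rw [presentation_eq]
  exact Z.localObs.add_mem (Z.localObs.add_mem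
    (Z.localObs.sum_mem fun j _ => Z.localObs.smul_mem _ (h4 j))
    (Z.localObs.sum_mem fun j _ => Z.localObs.smul_mem _ (h2 j))) hc

/-- The form with the presented polynomial in the first slot. [folklore] -/
theorem form_presentation_left (ω₂ : ℝ) {J J' : ℕ} (c : Fin J → ℝ) (f : Fin J → Fin 4 → TestFn)
    (d : Fin J' → ℝ) (g : Fin J' → Fin 2 → TestFn) (c₀ : ℝ)
    (h4 : ∀ j, wick ω₂ 1 4 (f j) ∈ Z.localObs) (h2 : ∀ j, wick ω₂ 1 2 (g j) ∈ Z.localObs)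
    (hconst : (fun _ : ChainConfig => c₀) ∈ Z.localObs) {b : ChainConfig → ℝ} (hb : b ∈ Z.localObs) :
    Z.form (fun σ : ChainConfig => (∑ j : Fin J, c j * wick ω₂ 1 4 (f j) σ) +
        (∑ j : Fin J', d j * wick ω₂ 1 2 (g j) σ) + c₀) b =
      ∑ j, c j * Z.form (wick ω₂ 1 4 (f j)) b + ∑ j, d j * Z.form (wick ω₂ 1 2 (g j)) b := by
  have h := presentation_eq ω₂ c f d g c₀ id
  simp only [comp_id] at h
  have hs4 : (∑ j, c j • wick ω₂ 1 4 (f j)) ∈ Z.localObs :=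
    Z.localObs.sum_mem fun j _ => Z.localObs.smul_mem _ (h4 j)
  have hs2 : (∑ j, d j • wick ω₂ 1 2 (g j)) ∈ Z.localObs :=
    Z.localObs.sum_mem fun j _ => Z.localObs.smul_mem _ (h2 j)
  rw [h, FluctuationStructure.form_add_left (Z.localObs.add_mem hs4 hs2) hconst hb,
    FluctuationStructure.form_add_left hs4 hs2 hb, form_const_left,
    form_sum_smul_left Z _ c (fun j _ => h4 j) hb, form_sum_smul_left Z _ d (fun j _ => h2 j) hb, add_zero]

/-- The form with the time-evolved presented polynomial in the second slot. [folklore] -/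
theorem form_presentation_comp_right (ω₂ : ℝ) {J J' : ℕ} (c : Fin J → ℝ) (f : Fin J → Fin 4 → TestFn)
    (d : Fin J' → ℝ) (g : Fin J' → Fin 2 → TestFn) (c₀ : ℝ) (θ : ChainConfig → ChainConfig)
    (h4 : ∀ j, wick ω₂ 1 4 (f j) ∘ θ ∈ Z.localObs) (h2 : ∀ j, wick ω₂ 1 2 (g j) ∘ θ ∈ Z.localObs)
    (hconst : (fun _ : ChainConfig => c₀) ∈ Z.localObs) {a : ChainConfig → ℝ} (ha : a ∈ Z.localObs) :
    Z.form a ((fun σ : ChainConfig => (∑ j : Fin J, c j * wick ω₂ 1 4 (f j) σ) +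
        (∑ j : Fin J', d j * wick ω₂ 1 2 (g j) σ) + c₀) ∘ θ) =
      ∑ j, c j * Z.form a (wick ω₂ 1 4 (f j) ∘ θ) + ∑ j, d j * Z.form a (wick ω₂ 1 2 (g j) ∘ θ) := by
  have hs4 : (∑ j, c j • (wick ω₂ 1 4 (f j) ∘ θ)) ∈ Z.localObs :=
    Z.localObs.sum_mem fun j _ => Z.localObs.smul_mem _ (h4 j)
  have hs2 : (∑ j, d j • (wick ω₂ 1 2 (g j) ∘ θ)) ∈ Z.localObs :=
    Z.localObs.sum_mem fun j _ => Z.localObs.smul_mem _ (h2 j)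
  rw [presentation_eq, FluctuationStructure.form_add_right ha (Z.localObs.add_mem hs4 hs2) hconst,
    FluctuationStructure.form_add_right ha hs4 hs2, form_const_right,
    form_sum_smul_right Z _ ha c (fun j _ => h4 j), form_sum_smul_right Z _ ha d (fun j _ => h2 j),
    add_zero]

/-- The inner product with the presentation vector `Ψ = Σ c_j ι[:f_j:] + Σ d_j ι[:g_j:]` in the first slot,
real part. [folklore] -/
theorem re_inner_presentation (ω₂ T : ℝ) {J J' : ℕ} (c : Fin J → ℝ) (f : Fin J → Fin 4 → TestFn)
    (d : Fin J' → ℝ) (g : Fin J' → Fin 2 → TestFn) (X : ChaosSpace) :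
    (⟪(∑ j, (c j : ℂ) • wickVector ω₂ T (f j)) + ∑ j, (d j : ℂ) • wickVector ω₂ T (g j), X⟫_ℂ).re =
      ∑ j, c j * (⟪wickVector ω₂ T (f j), X⟫_ℂ).re + ∑ j, d j * (⟪wickVector ω₂ T (g j), X⟫_ℂ).re := by
  rw [inner_add_left, sum_inner, sum_inner]
  simp_rw [inner_smul_left, Complex.conj_ofReal]
  rw [Complex.add_re, Complex.re_sum, Complex.re_sum]
  simp only [Complex.re_ofReal_mul]

/-- The inner product with the presentation vector in the first slot. [folklore] -/
theorem inner_presentation (ω₂ T : ℝ) {J J' : ℕ} (c : Fin J → ℝ) (f : Fin J → Fin 4 → TestFn)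
    (d : Fin J' → ℝ) (g : Fin J' → Fin 2 → TestFn) (X : ChaosSpace) :
    ⟪(∑ j, (c j : ℂ) • wickVector ω₂ T (f j)) + ∑ j, (d j : ℂ) • wickVector ω₂ T (g j), X⟫_ℂ =
      ∑ j, (c j : ℂ) * ⟪wickVector ω₂ T (f j), X⟫_ℂ + ∑ j, (d j : ℂ) * ⟪wickVector ω₂ T (g j), X⟫_ℂ := by
  rw [inner_add_left, sum_inner, sum_inner]
  simp_rw [inner_smul_left, Complex.conj_ofReal]

/-- The free evolution of the presentation vector, paired with a fixed vector, real part. [folklore] -/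
theorem re_inner_chaosKoopman_presentation (ω₂ T t : ℝ) {J J' : ℕ} (c : Fin J → ℝ)
    (f : Fin J → Fin 4 → TestFn) (d : Fin J' → ℝ) (g : Fin J' → Fin 2 → TestFn) (X : ChaosSpace) :
    (⟪X, chaosKoopman ω₂ t ((∑ j, (c j : ℂ) • wickVector ω₂ T (f j)) +
        ∑ j, (d j : ℂ) • wickVector ω₂ T (g j))⟫_ℂ).re =
      ∑ j, c j * (⟪X, chaosKoopman ω₂ t (wickVector ω₂ T (f j))⟫_ℂ).re +
        ∑ j, d j * (⟪X, chaosKoopman ω₂ t (wickVector ω₂ T (g j))⟫_ℂ).re := by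
  rw [map_add, map_sum, map_sum]
  simp_rw [LinearIsometryEquiv.map_smul]
  rw [inner_add_right, inner_sum, inner_sum]
  simp_rw [inner_smul_right]
  rw [Complex.add_re, Complex.re_sum, Complex.re_sum]
  simp only [Complex.re_ofReal_mul]

end Presentation

/-- **Transport of the generator identity along the Koopman group** (closed `∀`-form registered for this helper
file): if `s ↦ U_s[v]` has derivative `[w]` at `0`, then `s ↦ ⟪ψ, U_s[v]⟫` has derivative `⟪ψ, U_t[w]⟫` at `t`.
[folklore] -/
theorem inner_koopman_fluct_hasDerivAt :
    ∀ {P : OscillatorChain} {D : InfiniteChainDynamics P} (Z : ZeroWavenumberData P D) (ψ : ZeroWavenumberSpace Z)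
      (v w : ChainConfig → ℝ),
      HasDerivAt (fun s : ℝ => (Z.koopman s (Z.fluct v) : ZeroWavenumberSpace Z)) (Z.fluct w) 0 →
      ∀ t : ℝ, HasDerivAt (fun s : ℝ => ⟪ψ, Z.koopman s (Z.fluct v)⟫_ℝ) ⟪ψ, Z.koopman t (Z.fluct w)⟫_ℝ t :=
  fun Z ψ _ _ hv t => hasDerivAt_inner_koopman_fluct Z ψ hv t

end Summit.AtomisticToContinuum.FouriersLaw.Theorems.DrudeDissolution.GramPencilHarmonicChaos

end
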